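import Summits.KontsevichZagierPeriods.KontsevichZagierPeriods.Theorems.SoloBlindSerretReps
import HarnessLib

/-!
# Serret's integral inside the rules, II: a mixed period by two rational moves

`S = [T, ds dx/(s(1+x²))]`, `T = {1 ≤ s ≤ 1+x, x ≤ 1}`, represents Serret's integral
`∫₀¹ log(1+x) dx/(1+x²)` (data in `SoloBlindSerretReps`).  Its classical evaluation is the
substitution `x ↦ (1-x)/(1+x)`; we observe that the product involution
`Φ(s,x) = (2/s, (1-x)/(1+x))` maps `T` ONTO the complementary piece `T' = {0 ≤ x, 1+x ≤ s ≤ 2}`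
of the box `[1,2]×[0,1]`, PRESERVING the rational `2`-form `ds dx/(s(1+x²))` (`serret_pullback`),
so that inside Kontsevich–Zagier's rules (1)–(2), with `ℚ`-rational data throughout:

* `equivalent_serret_serret'`: `[T, f] ≡ [T', f]` by ONE change of variables (`exists_serretChart`:
  semialgebraic, injective, onto, `|det DΦ| = 4/(s²(1+x)²)`);
* `prod_sub_serret_sub_serret'`: `L × A = [T,f] + [T',f]` by ONE additivity move, where
  `L = [[1,2], dx/x]` and `A = [[0,1], dx/(1+x²)]`;
* hence `two_serret_sub_prod : 2·[S] - [L × A] ∈ relations` — **Serret's identity is two moves** —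
  and `serretRep_value : value S = π log 2 / 8`, obtained from the moves and the two cell values
  alone;
* `kz_serret` (conditional on `AlgIndepLogarithms`, via the box-ring kernel theorem): `S` is
  KZ-equivalent to every box-ring representation of period `π log 2 / 8`; `kz_serret_pinned`:
  the unconditional equivalence `S ≡ S'` for any representations with these data.

This is the first instance in this series of a mixed period (`π · log 2`), for which the
unconditional rank-one sector theorems (`kz_lineRing`, `kz_piSector`) do not apply.

References: J.-A. Serret (1844); M. Kontsevich, D. Zagier, *Periods* (2001), §1.2.
-/

noncomputable section

namespace Summit.KontsevichZagierPeriods.KontsevichZagierPeriods.Theorems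

open Set MeasureTheory
open Literature.ModelTheory.ExponentialFields (IsSemialgebraic)
open MvPolynomial (aeval X)
open Literature.NumberTheory.Transcendental
open Literature.NumberTheory.Transcendental.KZ
open Literature.Barriers.Schanuel (AlgIndepLogarithms)

namespace SoloBlind

/-! ## The involution chart -/

/-- **The pullback identity**: the rational `2`-form `ds dx/(s(1+x²))` is invariant under
`Φ(s,x) = (2/s, (1-x)/(1+x))`, whose Jacobian is `4/(s²(1+x)²)`. -/
theorem serret_pullback (z : Fin 2 → ℝ) (h0 : z 0 ≠ 0) (h1 : 1 + z 1 ≠ 0) :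
    1 / (z 0 * (1 + z 1 ^ 2)) =
      1 / (2 / z 0 * (1 + ((1 - z 1) / (1 + z 1)) ^ 2)) * (4 / (z 0 ^ 2 * (1 + z 1) ^ 2)) := by
  have h3 : (1 + z 1) ^ 2 + (1 - z 1) ^ 2 ≠ 0 := by positivity
  field_simp
  ring

/-- **The involution chart** `Φ(s,x) = (2/s, (1-x)/(1+x))`: a `ℚ`-rational map of `T` ONTO `T'`,
injective, with `|det DΦ| = 4/(s²(1+x)²)`. -/
theorem exists_serretChart :
    ∃ (Φ : (Fin 2 → ℝ) → (Fin 2 → ℝ)) (Φ' : (Fin 2 → ℝ) → (Fin 2 → ℝ) →L[ℝ] (Fin 2 → ℝ)),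
      (∀ z, Φ z 0 = 2 / z 0) ∧ (∀ z, Φ z 1 = (1 - z 1) / (1 + z 1)) ∧
      IsSemialgebraicMapOn ℚ kzSerret Φ ∧ (∀ z ∈ kzSerret, HasFDerivAt Φ (Φ' z) z) ∧
      InjOn Φ kzSerret ∧ Φ '' kzSerret = kzSerret' ∧
      (∀ z ∈ kzSerret, |(Φ' z).det| = 4 / (z 0 ^ 2 * (1 + z 1) ^ 2)) := by
  set Φ : (Fin 2 → ℝ) → (Fin 2 → ℝ) := fun z => ![2 / z 0, (1 - z 1) / (1 + z 1)] with hΦ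
  set Φ' : (Fin 2 → ℝ) → (Fin 2 → ℝ) →L[ℝ] (Fin 2 → ℝ) :=
    fun z => LinearMap.toContinuousLinearMap (Matrix.toLin'
      !![-2 / z 0 ^ 2, 0; 0, -2 / (1 + z 1) ^ 2]) with hΦ'
  have hΦ0 : ∀ z, Φ z 0 = 2 / z 0 := fun z => rfl
  have hΦ1 : ∀ z, Φ z 1 = (1 - z 1) / (1 + z 1) := fun z => rfl
  have hΦ'0 : ∀ z v : Fin 2 → ℝ, Φ' z v 0 = -2 / z 0 ^ 2 * v 0 := by
    intro z v
    change Matrix.toLin' !![-2 / z 0 ^ 2, 0; 0, -2 / (1 + z 1) ^ 2] v 0 = _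
    rw [Matrix.toLin'_apply]
    simp [Matrix.mulVec, dotProduct, Fin.sum_univ_two]
  have hΦ'1 : ∀ z v : Fin 2 → ℝ, Φ' z v 1 = -2 / (1 + z 1) ^ 2 * v 1 := by
    intro z v
    change Matrix.toLin' !![-2 / z 0 ^ 2, 0; 0, -2 / (1 + z 1) ^ 2] v 1 = _
    rw [Matrix.toLin'_apply]
    simp [Matrix.mulVec, dotProduct, Fin.sum_univ_two]
  have hdet : ∀ z : Fin 2 → ℝ, (Φ' z).det = 4 / (z 0 ^ 2 * (1 + z 1) ^ 2) := by
    intro z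
    change LinearMap.det (Matrix.toLin' !![-2 / z 0 ^ 2, 0; 0, -2 / (1 + z 1) ^ 2]) = _
    rw [LinearMap.det_toLin', Matrix.det_fin_two]
    simp only [Matrix.of_apply, Matrix.cons_val', Matrix.cons_val_zero, Matrix.cons_val_one,
      Matrix.cons_val_fin_one, Matrix.empty_val']
    rw [mul_zero, sub_zero, div_mul_div_comm]
    norm_num
  have hderiv : ∀ z : Fin 2 → ℝ, z 0 ≠ 0 → 1 + z 1 ≠ 0 → HasFDerivAt Φ (Φ' z) z := by
    intro z hz0 hz1
    have h0 : HasFDerivAt (fun y : Fin 2 → ℝ => y 0)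
        (ContinuousLinearMap.proj (R := ℝ) (φ := fun _ : Fin 2 => ℝ) 0) z := hasFDerivAt_apply 0 z
    have h1 : HasFDerivAt (fun y : Fin 2 → ℝ => y 1)
        (ContinuousLinearMap.proj (R := ℝ) (φ := fun _ : Fin 2 => ℝ) 1) z := hasFDerivAt_apply 1 z
    have hinv0 : HasFDerivAt (fun y : Fin 2 → ℝ => (y 0)⁻¹)
        ((ContinuousLinearMap.toSpanSingleton ℝ (-(z 0 ^ 2)⁻¹)).comp
          (ContinuousLinearMap.proj (R := ℝ) (φ := fun _ : Fin 2 => ℝ) 0)) z :=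
      (hasFDerivAt_inv hz0).comp z h0
    have hinv1 : HasFDerivAt (fun y : Fin 2 → ℝ => (1 + y 1)⁻¹)
        ((ContinuousLinearMap.toSpanSingleton ℝ (-((1 + z 1) ^ 2)⁻¹)).comp
          (ContinuousLinearMap.proj (R := ℝ) (φ := fun _ : Fin 2 => ℝ) 1)) z :=
      (hasFDerivAt_inv hz1).comp z (h1.const_add 1)
    rw [hasFDerivAt_pi']
    refine Fin.forall_fin_two.mpr ⟨?_, ?_⟩
    · have hf : (fun y : Fin 2 → ℝ => Φ y 0) = fun y => 2 * (y 0)⁻¹ :=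
        funext fun y => by rw [hΦ0, div_eq_mul_inv]
      rw [hf]
      refine (hinv0.const_mul 2).congr_fderiv (ContinuousLinearMap.ext fun v => ?_)
      simp [hΦ'0]
      ring
    · have hf : (fun y : Fin 2 → ℝ => Φ y 1) = fun y => (1 - y 1) * (1 + y 1)⁻¹ :=
        funext fun y => by rw [hΦ1, div_eq_mul_inv]
      rw [hf]
      refine ((h1.const_sub 1).mul hinv1).congr_fderiv (ContinuousLinearMap.ext fun v => ?_)
      simp [hΦ'1]
      field_simp
      ring
  refine ⟨Φ, Φ', hΦ0, hΦ1, ?_, fun z hz => hderiv z (by rw [mem_kzSerret] at hz; linarith [hz.1])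
    (by rw [mem_kzSerret] at hz; linarith [hz.1, hz.2.1]), ?_, ?_, fun z _ => ?_⟩
  · refine IsSemialgebraicMapOn.of_forall isSemialgebraic_kzSerret
      (Fin.forall_fin_two.mpr ⟨?_, ?_⟩)
    · refine (isSemialgebraicFunOn_aeval_div_aeval isSemialgebraic_kzSerret
        (2 : MvPolynomial (Fin 2) ℚ) (X 0) fun x hx => ?_).congr fun x _ => by simp [hΦ0]
      rw [mem_kzSerret] at hx
      have : (0:ℝ) < x 0 := by linarith [hx.1]
      simpa using this.ne'
    · refine (isSemialgebraicFunOn_aeval_div_aeval isSemialgebraic_kzSerret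
        (1 - X 1 : MvPolynomial (Fin 2) ℚ) (1 + X 1) fun x hx => ?_).congr
        fun x _ => by simp [hΦ1]
      rw [mem_kzSerret] at hx
      have : (0:ℝ) < 1 + x 1 := by linarith [hx.1, hx.2.1]
      simpa using this.ne'
  · intro x hx y hy hxy
    have e0 := congrFun hxy 0
    have e1 := congrFun hxy 1
    simp only [hΦ0, hΦ1] at e0 e1
    rw [mem_kzSerret] at hx hy
    have hx0 : x 0 ≠ 0 := by
      have : (0:ℝ) < x 0 := by linarith [hx.1]
      exact this.ne'
    have hy0 : y 0 ≠ 0 := by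
      have : (0:ℝ) < y 0 := by linarith [hy.1]
      exact this.ne'
    have hx1 : 1 + x 1 ≠ 0 := by
      have : (0:ℝ) < 1 + x 1 := by linarith [hx.1, hx.2.1]
      exact this.ne'
    have hy1 : 1 + y 1 ≠ 0 := by
      have : (0:ℝ) < 1 + y 1 := by linarith [hy.1, hy.2.1]
      exact this.ne'
    have h00 : x 0 = y 0 := by
      field_simp at e0
      linarith
    have h11 : x 1 = y 1 := by
      rw [div_eq_div_iff hx1 hy1] at e1
      linarith
    funext i
    fin_cases i
    · exact h00
    · exact h11
  · ext w
    constructor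
    · rintro ⟨z, hz, rfl⟩
      rw [mem_kzSerret] at hz
      obtain ⟨h1, h2, h3⟩ := hz
      have hp : 0 < 1 + z 1 := by linarith
      have hz0 : 0 < z 0 := by linarith
      rw [mem_kzSerret']
      simp only [hΦ0, hΦ1]
      refine ⟨div_nonneg (by linarith) hp.le, ?_, ?_⟩
      · rw [add_div' _ _ _ hp.ne', div_le_div_iff₀ hp hz0]
        nlinarith
      · rw [div_le_iff₀ hz0]
        linarith
    · intro hw
      rw [mem_kzSerret'] at hw
      obtain ⟨h1, h2, h3⟩ := hw
      have hp : 0 < 1 + w 1 := by linarith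
      have hw0 : 0 < w 0 := by linarith
      refine ⟨![2 / w 0, (1 - w 1) / (1 + w 1)], ?_, ?_⟩
      · rw [mem_kzSerret]
        change 1 ≤ 2 / w 0 ∧ 2 / w 0 ≤ 1 + (1 - w 1) / (1 + w 1) ∧ (1 - w 1) / (1 + w 1) ≤ 1
        refine ⟨?_, ?_, ?_⟩
        · rw [le_div_iff₀ hw0]
          linarith
        · rw [add_div' _ _ _ hp.ne', div_le_div_iff₀ hw0 hp]
          nlinarith
        · rw [div_le_one hp]
          linarith
      · funext i
        fin_cases i
        · change 2 / (2 / w 0) = w 0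
          field_simp
        · change (1 - (1 - w 1) / (1 + w 1)) / (1 + (1 - w 1) / (1 + w 1)) = w 1
          have hp' : 1 + w 1 ≠ 0 := hp.ne'
          have h2' : (2:ℝ) ≠ 0 := two_ne_zero
          field_simp
          ring
  · rw [hdet z]
    exact abs_of_pos (by
      rw [mem_kzSerret] at *
      have hz0 : 0 < z 0 := by linarith
      have hp : 0 < 1 + z 1 := by linarith
      positivity)

/-! ## The two moves -/

/-- **Move (change of variables)**: the involution carries `[T, f]` onto `[T', f]`. -/
theorem equivalent_serret_serret' : Equivalent serretRep serretRep' := by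
  obtain ⟨Φ, Φ', hΦ0, hΦ1, hsa, hderiv, hinj, himage, hdet⟩ := exists_serretChart
  refine equivalent_of_chart hsa hderiv hinj himage hdet
    (f := fun z : Fin 2 → ℝ => 1 / (z 0 * (1 + z 1 ^ 2)))
    (g := fun w : Fin 2 → ℝ => 1 / (w 0 * (1 + w 1 ^ 2))) (fun z hz => ?_) rfl (fun _ _ => rfl)
    rfl (fun _ _ => rfl)
  simp only [hΦ0, hΦ1]
  rw [mem_kzSerret] at hz
  exact serret_pullback z (by linarith [hz.1]) (by linarith [hz.1, hz.2.1])

/-- **Move (additivity)**: `L × A = [T, f] + [T', f]`, the overlap `{s = 1+x}` being null. -/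
theorem prod_sub_serret_sub_serret' :
    of (logTwoCell.prod atanOneCell) - of serretRep - of serretRep' ∈ relations := by
  refine domainAddRel_subset_relations ⟨2, logTwoCell.prod atanOneCell, serretRep, serretRep',
    ?_, volume_kzSerret_inter, fun z _ => prod_log_atan_integrand z,
    fun z _ => prod_log_atan_integrand z, rfl⟩
  rw [prod_log_atan_domain, kzBox_eq_union]
  rfl

/-- **Serret's identity is two Kontsevich–Zagier moves**: `2·[S] - [L × A] ∈ relations`. -/
theorem two_serret_sub_prod :
    2 • of serretRep - of (logTwoCell.prod atanOneCell) ∈ relations := by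
  have h := sub_mem equivalent_serret_serret' prod_sub_serret_sub_serret'
  convert h using 1
  abel

/-! ## Consequences -/

/-- **Serret's integral, evaluated by the moves**: `value S = π log 2 / 8`, i.e.
`∫₀¹ log(1+x) dx/(1+x²) = (π/8) log 2`, with no integration beyond the two cells `L`, `A`. -/
theorem serretRep_value : serretRep.value = Real.pi * Real.log 2 / 8 := by
  have h := relations_le_ker_eval_holds two_serret_sub_prod
  rw [AddMonoidHom.mem_ker, map_sub, map_nsmul, eval_of, eval_of, prod_log_atan_value,
    sub_eq_zero, nsmul_eq_mul, Nat.cast_ofNat] at h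
  linear_combination h / 2

/-- In `Q`: `2·[S] = [L]·[A]`. -/
theorem two_smul_mkQ_serretRep :
    2 • mkQ (of serretRep) = mkQ (of logTwoCell) * mkQ (of atanOneCell) := by
  rw [← mkQ_mul, of_mul_of, ← map_nsmul, mkQ_eq_mkQ_iff]
  exact two_serret_sub_prod

/-- `relations` is `2`-saturated (indeed divisible-saturated: `Q` is a `ℚ̄ ∩ ℝ`-vector space). -/
theorem mem_relations_of_two_nsmul_mem {z : FormalRep} (h : 2 • z ∈ relations) :
    z ∈ relations := by
  rw [← mkQ_eq_zero_iff] at h ⊢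
  rw [map_nsmul, ← ofNat_smul_eq_nsmul K₀] at h
  exact (smul_eq_zero.mp h).resolve_left two_ne_zero

/-- **Serret's integral and the Kontsevich–Zagier conjecture (conditional form).**  Under
`AlgIndepLogarithms`, `S` is KZ-equivalent to every representation in the box ring whose period
is `π log 2 / 8` — e.g. to `[[1,2], dx/2x] × [[0,1], dx/(4(1+y²))]`, or to any product of
rational cells with that value. -/
theorem kz_serret (h : AlgIndepLogarithms) {m : ℕ} (r' : IntegralRep m) (hr' : of r' ∈ boxRing)
    (hv : r'.value = Real.pi * Real.log 2 / 8) : Equivalent serretRep r' := by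
  -- `2·[r'] - [L × A]` lies in the box ring and has value `0`
  have h1 : 2 • of r' - of (logTwoCell.prod atanOneCell) ∈ relations :=
    boxRing_kernel h (sub_mem (nsmul_mem hr' 2) of_prod_log_atan_mem_boxRing) (by
      rw [map_sub, map_nsmul, eval_of, eval_of, hv, prod_log_atan_value, nsmul_eq_mul,
        Nat.cast_ofNat]
      ring)
  have h2 := sub_mem two_serret_sub_prod h1
  refine mem_relations_of_two_nsmul_mem ?_
  convert h2 using 1
  rw [nsmul_sub]
  abel

/-- The unconditional content, pinned: any two rational representations with the data of `S`
and of `S'` are equivalent. -/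
theorem kz_serret_pinned (r r' : IntegralRep 2) (hrd : r.domain = kzSerret)
    (hri : EqOn r.integrand (fun z => 1 / (z 0 * (1 + z 1 ^ 2))) kzSerret)
    (hr'd : r'.domain = kzSerret')
    (hr'i : EqOn r'.integrand (fun z => 1 / (z 0 * (1 + z 1 ^ 2))) kzSerret') :
    Equivalent r r' := by
  obtain ⟨Φ, Φ', hΦ0, hΦ1, hsa, hderiv, hinj, himage, hdet⟩ := exists_serretChart
  refine equivalent_of_chart hsa hderiv hinj himage hdet
    (f := fun z : Fin 2 → ℝ => 1 / (z 0 * (1 + z 1 ^ 2)))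
    (g := fun w : Fin 2 → ℝ => 1 / (w 0 * (1 + w 1 ^ 2))) (fun z hz => ?_) hrd hri hr'd hr'i
  simp only [hΦ0, hΦ1]
  rw [mem_kzSerret] at hz
  exact serret_pullback z (by linarith [hz.1]) (by linarith [hz.1, hz.2.1])

end SoloBlind

end Summit.KontsevichZagierPeriods.KontsevichZagierPeriods.Theorems
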